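import Summits.BirchSwinnertonDyer.BirchSwinnertonDyer.Theorems.EisensteinPrimesH2BookkeepingCruxPlaces
import Summits.BirchSwinnertonDyer.BirchSwinnertonDyer.Theorems.EisensteinPrimesH2BookkeepingDescent
import Summits.BirchSwinnertonDyer.BirchSwinnertonDyer.Theorems.EisensteinPrimesWeakLeopoldtAboveCurve
import Summits.BirchSwinnertonDyer.BirchSwinnertonDyer.Theorems.EisensteinPrimesWeakLeopoldtAboveCharModuleAt
import Summits.BirchSwinnertonDyer.BirchSwinnertonDyer.Theorems.EisensteinPrimesIndexInputsH0
import Summits.BirchSwinnertonDyer.BirchSwinnertonDyer.Theorems.EisensteinPrimesCharResidualSelmerKummer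
import Summits.BirchSwinnertonDyer.BirchSwinnertonDyer.Theorems.SignedBaseChangeAnticyclotomicEisensteinDivisibilityCurveModel
import Summits.BirchSwinnertonDyer.Rank1Residual.X2.ResidualDevissageModules
import HarnessLib

/-!
# The `H²` conjunct of halves v20.1 `stub_indexInputs`, PRODUCED in the crux's binders
# (cell `bsd-eis`, seat `bsd-line-x1-p1-w4` gen 5; crux 2 `GoodLatticeBDPValue` stmt-BirchSwinnertonDyer-19032, line `halves`
# v20.1 a012386a, `stub_indexInputs` l.342–348 — V21 index road input S4, end-to-end modulo PUB)

HONEST FRAMING (cell `bsd-eis`, run/shared/lean/pub/bsd-eis/): theorems only (no definition, no named fact introduced, no `sorry`,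
no `Theses` import). The PUBLISHED facts Greenberg 2006 Props. 4.1, 4.2, §5 A, 3.2 (`prop41_…`, `prop42_…`, `sec5A_…`, `prop32_…`)
and `cd_p(G_{K,Σ}) ≤ 2` (`GaloisCohomology.groupCdLE_two_galoisGroupUnramifiedOutside K`, Harari Cor. 17.14 / NSW (8.3.18)) enter
as HYPOTHESES by name, as do halves v20.1's own cotorsion antecedents `hSsub` / `hSquot`; BSD / IMC2 / KY Thm. 1.4.1 are proved for
NO curve here. Helper `--supports stmt-BirchSwinnertonDyer-19032`; closes no registered stub by itself (it discharges ONE of the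
thirty conjuncts of `stub_indexInputs`, for every choice of the line data `Φ, j₁, j₃`).

## What

The last conjunct `hH2` of `stub_indexInputs` is the index bookkeeping
`[U(E[p]/Φ) : q_* U(E[p])] · #(U(E[p^∞])/p) = #(U((F/𝒪)(θsub))/p) · #(U((F/𝒪)(θquot))/p)` over `K_∞ = K̄^{ker κ}`
(`U(·) = unramifiedOutside (ker κ) · p ↑Sf`). w4 gen 4's file (F) `H2BookkeepingCruxPlaces.natCard_H2bookkeeping_unramifiedOutside_insert_insert`
(p649361) proves it from: the residual/Kummer data, continuity of the orbit maps, the three `p`-divisible modules DESCENDED to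
`G_{K,Σ}` (`Σ = {v, v̄} ∪ Sf`) with weak Leopoldt `H²(K_Σ/K_∞, A_k) = 0`, and CD2. THIS FILE supplies every remaining input from
the crux's binders and tree theorems:

* §1 the three descents with `ℤ`-coefficients (`exists_descent_charModule` — Néron–Ogg–Shafarevich for the Teichmüller characters,
  `AcTwistDeformationResidualPair.ramificationSubgroup_le_ker_unitChar_of_residualPair` + the model `characterRepUnramified`, transported
  by (G) `exists_continuousRep_quot_of_addEquiv`; `exists_descent_geomPrimaryTorsion` — bsd-ssimc's
  `SignedBaseChangeAcDivCurveModel.exists_continuousRep_primaryTorsion` along `PrimaryTorsion E_K(K̄) p = E_K[p^∞]`);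
* §2 the conjunct: **`natCard_H2_conjunct`** — for EVERY `Γ_K`-stable `Φ ≤ E_K[p]` with equivariant Kummer embeddings
  `j₁ : Φ ↪ (F/𝒪)(θsub)`, `j₃ : E_K[p]/Φ ↪ (F/𝒪)(θquot)` onto the `p`-torsion, GRANTED {h41, h42, h5A, h32, hCD2} and v20.1's
  `hSsub`/`hSquot`, the `hH2` equation VERBATIM (w2 gen 4's WL ×3 `WeakLeopoldtAboveCurve.subsingleton_H_two_above_geomPrimaryTorsion`,
  `WeakLeopoldtAboveCharModuleAt.subsingleton_H_two_above_charModule_of_cotorsion_at` at the §1 descents, then (F)).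

References: [KellerYin2024] §1.4 (proof of Thm. 1.4.1 (iii), arXiv:2402.12781v2 TeX L1183–1330); [Greenberg2006] Thm. 3, Props.
3.2, 4.1–4.2, §5 A; [NeukirchSchmidtWingberg2008] (8.3.18), VIII §3; [Harari2020] Cor. 17.14; [SilvermanAEC2009] VII.4.1.
-/

set_option autoImplicit false
set_option linter.dupNamespace false -- the summit namespace `…BirchSwinnertonDyer.BirchSwinnertonDyer.Theorems` (Sub = Summit, D-0017) trips it

noncomputable section

open scoped Classical
open Function NumberField IsDedekindDomain Field WeierstrassCurve
open Literature.NumberTheory.EllipticCurves Literature.NumberTheory.EllipticCurves.GreenbergSelmer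
  Literature.NumberTheory.EllipticCurves.GreenbergVatsal2000 Literature.NumberTheory.GaloisRepresentations
  Literature.NumberTheory.GaloisCohomology
  Literature.NumberTheory.EllipticCurves.KellerYin2024 Literature.NumberTheory.EllipticCurves.IwasawaDual
  Literature.NumberTheory.IwasawaTheory Literature.NumberTheory.IwasawaTheory.Greenberg2016
  Literature.NumberTheory.IwasawaTheory.Greenberg2006
  Summit.BirchSwinnertonDyer.Rank1Residual.X2.ResidualDevissageModules
  Summit.BirchSwinnertonDyer.BirchSwinnertonDyer.Theorems.GreenbergFullAtSelmer
  Summit.BirchSwinnertonDyer.BirchSwinnertonDyer.Theorems.AcTwistDeformationResidualPair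
  Summit.BirchSwinnertonDyer.BirchSwinnertonDyer.Theorems.UnramifiedInflation

namespace Summit.BirchSwinnertonDyer.BirchSwinnertonDyer.Theorems.IndexInputsH2

variable {K : Type} [Field K] [NumberField K] {p : ℕ} [Fact p.Prime]

/-! ## §1 The three descents to `G_{K,Σ}` with `ℤ`-coefficients -/

/-- **`(F/𝒪)(θ)` descends to `G_{K,S}`** (`ℤ`-coefficients, on its own carrier) for `θ ∈ {θsub, θquot}` a residual character of
`E_K[p]` and any `S ⊇ Sf ∪ {w ∣ p}`: both characters are Teichmüller lifts unramified outside `S` (Néron–Ogg–Shafarevich), so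
`N_S ≤ ker θ`; transport the model `ρ_θ = characterRepUnramified S θ h` on `ℚ_p/ℤ_p` along `(charModuleEquiv θ)⁻¹`.
[cite: KellerYin2024, Rem. 1.2.3 (ii) and §1.4 (arXiv:2402.12781v2 TeX L690–712, L1063–1086)] [cite: SilvermanAEC2009, Prop. VII.4.1 (a)]
[cite: NeukirchSchmidtWingberg2008, VIII §3] -/
theorem exists_descent_charModule (W : WeierstrassCurve ℚ) [W.IsElliptic]
    {θsub θquot : FramedGaloisRep K (padicCoeffIntegers (∅ : Set (PadicAlgCl p))) 1}
    (hpair : IsResidualPairOver (W.baseChange K) p θsub θquot)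
    (Sf : Finset (HeightOneSpectrum (𝓞 K)))
    (hSf : ∀ w : HeightOneSpectrum (𝓞 K), w ∈ Sf ↔ ((W.conductorNorm ℤ : ℤ) : 𝓞 K) ∈ w.asIdeal)
    (S : Set (HeightOneSpectrum (𝓞 K))) (hSfS : ∀ w ∈ Sf, w ∈ S)
    (hS : ∀ w : HeightOneSpectrum (𝓞 K), ((p : ℕ) : 𝓞 K) ∈ w.asIdeal → w ∈ S)
    (θ : FramedGaloisRep K (padicCoeffIntegers (∅ : Set (PadicAlgCl p))) 1) (hθ : θ = θsub ∨ θ = θquot) :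
    ∃ ρA : ContinuousRep (GaloisGroupUnramifiedOutside K S) ℤ (charModule (∅ : Set (PadicAlgCl p)) θ),
      ∀ (σ : absoluteGaloisGroup K) (m : charModule (∅ : Set (PadicAlgCl p)) θ), ρA (toUnramifiedQuot K S σ) m = σ • m := by
  have h : ramificationSubgroup K S ≤ (unitChar θ).toMonoidHom.ker :=
    ramificationSubgroup_le_ker_unitChar_of_residualPair W hpair Sf hSf S hSfS hS θ hθ
  haveI : DiscreteTopology (QpModZp p) := QpModZp.discreteTopology p
  haveI : ContinuousSMul ℤ_[p] (QpModZp p) := QpModZp.continuousSMul p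
  exact exists_continuousRep_quot_of_addEquiv S (CharResidualSelmerCount.continuous_smul_charModule θ)
    (characterRepUnramified S θ h).toRepresentation (charModuleEquiv θ).symm
    (fun σ a ↦ charModuleEquiv_symm_galois S θ h σ a)

omit [NumberField K] [Fact p.Prime] in
/-- Orbit maps of `Γ_K` on `E_K[p^∞] = ↥(E.geomPrimaryTorsion p)` are continuous (stabilisers are open).
[cite: SerreGaloisCohomology1997, II §1.1] -/
theorem continuous_smul_geomPrimaryTorsion (E : WeierstrassCurve K) (P : ↥(E.geomPrimaryTorsion p)) :
    Continuous fun g : absoluteGaloisGroup K ↦ g • P :=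
  CharResidualSelmerCount.continuous_smul_const_of_isOpen_stabilizer P (AcSigned.isOpen_stabilizer_geomPrimaryTorsion E P)

omit [NumberField K] [Fact p.Prime] in
/-- Orbit maps of `Γ_K` on `E_K[n] = ↥(E.geomTorsion n)` are continuous (`E(K̄)` is a discrete `Γ_K`-module).
[cite: SerreGaloisCohomology1997, II §1.1] -/
theorem continuous_smul_geomTorsion (E : WeierstrassCurve K) (n : ℤ) (P : ↥(E.geomTorsion n)) :
    Continuous fun g : absoluteGaloisGroup K ↦ g • P :=
  continuous_of_injective_comp (ι := ((↑) : ↥(E.geomTorsion n) → E.geomPoints)) Subtype.val_injective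
    (E.continuous_smul_geomPoints (P : E.geomPoints))

/-- **`E_K[p^∞]` descends to `G_{K,S}`** (`ℤ`-coefficients, on the carrier `↥(E_K.geomPrimaryTorsion p)`) for `S ⊇ Sf ∪ {w ∣ p}`,
`Sf` = the places over `N_E`: Néron–Ogg–Shafarevich (`N_S` fixes `E[p^∞]`, bsd-ssimc's
`smul_primaryTorsion_eq_of_mem_ramificationSubgroup` / `exists_continuousRep_primaryTorsion`), transported along the identity
`PrimaryTorsion E_K(K̄) p = E_K[p^∞]`. [cite: SilvermanAEC2009, Prop. VII.4.1 (a), Thm. VII.7.1] [cite: NeukirchSchmidtWingberg2008, VIII §3] -/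
theorem exists_descent_geomPrimaryTorsion (W : WeierstrassCurve ℚ) [W.IsElliptic]
    (Sf : Finset (HeightOneSpectrum (𝓞 K)))
    (hSf : ∀ w : HeightOneSpectrum (𝓞 K), w ∈ Sf ↔ ((W.conductorNorm ℤ : ℤ) : 𝓞 K) ∈ w.asIdeal)
    (S : Set (HeightOneSpectrum (𝓞 K))) (hSfS : ∀ w ∈ Sf, w ∈ S)
    (hS : ∀ w : HeightOneSpectrum (𝓞 K), ((p : ℕ) : 𝓞 K) ∈ w.asIdeal → w ∈ S) :
    ∃ ρA : ContinuousRep (GaloisGroupUnramifiedOutside K S) ℤ ↥((W.baseChange K).geomPrimaryTorsion p),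
      ∀ (σ : absoluteGaloisGroup K) (P : ↥((W.baseChange K).geomPrimaryTorsion p)), ρA (toUnramifiedQuot K S σ) P = σ • P := by
  haveI hEK : (W.baseChange K).IsElliptic := inferInstanceAs (W.map (algebraMap ℚ K)).IsElliptic
  have hgoodN : ∀ w : HeightOneSpectrum (𝓞 K), w ∉ Sf → (W.baseChange K).HasGoodReductionAt w := fun w hw ↦
    EisensteinPrimesMuLambda.hasGoodReductionAt_baseChange_of_conductorNorm_notMem W w fun h ↦ hw ((hSf w).mpr h)
  have hSbad : ∀ w : HeightOneSpectrum (𝓞 K), ¬ (W.baseChange K).HasGoodReductionAt w → w ∈ S :=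
    fun w hw ↦ hSfS w (by_contra fun hw' ↦ hw (hgoodN w hw'))
  have hNS : ∀ n ∈ ramificationSubgroup K S, ∀ P : PrimaryTorsion (W.baseChange K).geomPoints p, n • P = P :=
    fun n hn P ↦ SignedBaseChangeAcDivCurveModel.smul_primaryTorsion_eq_of_mem_ramificationSubgroup
      (W.baseChange K) p S hSbad hS hn P
  obtain ⟨ρ₀, hρ₀⟩ := SignedBaseChangeAcDivCurveModel.exists_continuousRep_primaryTorsion (W.baseChange K) p S hNS
  let ψ : PrimaryTorsion (W.baseChange K).geomPoints p ≃+ ↥((W.baseChange K).geomPrimaryTorsion p) :=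
    AddEquiv.refl (PrimaryTorsion (W.baseChange K).geomPoints p)
  refine exists_continuousRep_quot_of_addEquiv S (continuous_smul_geomPrimaryTorsion (W.baseChange K))
    ρ₀.toRepresentation ψ fun σ a ↦ ?_
  change ρ₀ (toUnramifiedQuot K S σ) a = σ • a
  rw [hρ₀]

/-! ## §2 The `H²` conjunct of `stub_indexInputs` -/

/-- **The `H²` bookkeeping conjunct `hH2` of halves v20.1 `stub_indexInputs`, in the crux's binders, modulo PUB.** For `E = W/ℚ`
base-changed to the imaginary quadratic `K` with (Heeg) for `N_E`, `2 < p = v v̄` split (`v` through `ι`, `v̄ ≠ v`), `κ`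
anticyclotomic with topological generator `γ` (`K_∞ = K̄^{ker κ}`), a residual pair `θsub, θquot` of `E[p]` over `K`, `Sf` = the
places over `N_E`, halves v20.1's cotorsion clauses `hSsub` / `hSquot` ([PWL-θ], VERBATIM), and for EVERY `Γ_K`-stable
`Φ ≤ E_K[p]` with equivariant injective Kummer maps `j₁ : Φ ↪ (F/𝒪)(θsub)`, `j₃ : E_K[p]/Φ ↪ (F/𝒪)(θquot)` onto the `p`-torsion:
GRANTED Greenberg 2006 Props. 4.1, 4.2, §5 A, 3.2 and `cd_p(G_{K,Σ}) ≤ 2` BY NAME,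
`[U(E_K[p]/Φ) : q_* U(E_K[p])] · #(U(E_K[p^∞])/p) = #(U((F/𝒪)(θsub))/p) · #(U((F/𝒪)(θquot))/p)` with
`U(·) = unramifiedOutside (ker κ) · p ↑Sf` — the last conjunct of `stub_indexInputs` (l.342–348) VERBATIM. Proof: (F)
`natCard_H2bookkeeping_unramifiedOutside_insert_insert` at the §1 descents, weak Leopoldt from w2 gen 4's
`subsingleton_H_two_above_geomPrimaryTorsion` / `subsingleton_H_two_above_charModule_of_cotorsion_at`.
[cite: KellerYin2024, §1.4 (proof of Thm. 1.4.1 (iii), arXiv:2402.12781v2 TeX L1183–1330)] [cite: Greenberg2006, Thm. 3 p. 342, Props. 3.2, 4.1–4.2, §5 A]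
[cite: NeukirchSchmidtWingberg2008, (8.3.18)] [cite: Harari2020, Cor. 17.14 (p. 295)] -/
theorem natCard_H2_conjunct (hCD2 : groupCdLE_two_galoisGroupUnramifiedOutside K)
    (h41 : prop41_globalEulerPoincareCorank) (h42 : prop42_localEulerPoincareCorank)
    (h5A : sec5A_localH2_subsingleton_of_LOC1) (h32 : prop32_cohomology_isCofinitelyGenerated)
    (W : WeierstrassCurve ℚ) [W.IsElliptic] (hp : 2 < p) (hK : IsImaginaryQuadratic K)
    (hH : SatisfiesHeegnerHypothesis (W.conductorNorm ℤ) K)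
    {ι : K →+* ℚ_[p]} {v vbar : HeightOneSpectrum (𝓞 K)}
    (hvι : ∀ x : 𝓞 K, x ∈ v.asIdeal ↔ ‖ι (x : K)‖ < 1)
    (hvbar : ((p : ℕ) : 𝓞 K) ∈ vbar.asIdeal) (hne : vbar ≠ v)
    (κ : ZpExtension K p) (hκ : κ.IsAnticyclotomic) (γ : absoluteGaloisGroup K) [Fact (κ.IsTopGenerator γ)]
    {θsub θquot : FramedGaloisRep K (padicCoeffIntegers (∅ : Set (PadicAlgCl p))) 1}
    (hpair : IsResidualPairOver (W.baseChange K) p θsub θquot)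
    (Sf : Finset (HeightOneSpectrum (𝓞 K)))
    (hSf : ∀ w : HeightOneSpectrum (𝓞 K), w ∈ Sf ↔ ((W.conductorNorm ℤ : ℤ) : 𝓞 K) ∈ w.asIdeal)
    (hSsub : ∀ D : DatumDualData κ γ (charModule (∅ : Set (PadicAlgCl p)) θsub)
      (Castella2018.AcSelmer.bdpData (charModule (∅ : Set (PadicAlgCl p)) θsub) p vbar) (↑Sf : Set (HeightOneSpectrum (𝓞 K))),
      Module.Finite (IwasawaAlgebra p) D.X ∧ Module.IsTorsion (IwasawaAlgebra p) D.X ∧ muInvariant p D.X = 0)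
    (hSquot : ∀ D : DatumDualData κ γ (charModule (∅ : Set (PadicAlgCl p)) θquot)
      (Castella2018.AcSelmer.bdpData (charModule (∅ : Set (PadicAlgCl p)) θquot) p vbar) (↑Sf : Set (HeightOneSpectrum (𝓞 K))),
      Module.Finite (IwasawaAlgebra p) D.X ∧ Module.IsTorsion (IwasawaAlgebra p) D.X ∧ muInvariant p D.X = 0)
    (Φ : StableSubgroup (absoluteGaloisGroup K) ↥((W.baseChange K).geomTorsion (p : ℤ)))
    (j₁ : Φ.Sub →+ charModule (∅ : Set (PadicAlgCl p)) θsub) (j₃ : Φ.Quot →+ charModule (∅ : Set (PadicAlgCl p)) θquot)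
    (hj₁ : ∀ (g : absoluteGaloisGroup K) (a : Φ.Sub), j₁ (g • a) = g • j₁ a)
    (hj₃ : ∀ (g : absoluteGaloisGroup K) (a : Φ.Quot), j₃ (g • a) = g • j₃ a)
    (hj₁inj : Injective j₁) (hj₃inj : Injective j₃)
    (hr₁ : ∀ x : charModule (∅ : Set (PadicAlgCl p)) θsub, x ∈ j₁.range ↔ p • x = 0)
    (hr₃ : ∀ x : charModule (∅ : Set (PadicAlgCl p)) θquot, x ∈ j₃.range ↔ p • x = 0) :
    Nat.card (↥(unramifiedOutside κ.kerSubgroup Φ.Quot p (↑Sf : Set (HeightOneSpectrum (𝓞 K)))) ⧸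
        ((unramifiedOutside κ.kerSubgroup ↥((W.baseChange K).geomTorsion (p : ℤ)) p (↑Sf : Set (HeightOneSpectrum (𝓞 K)))).map
          (resH1Hom (ContinuousMonoidHom.id ↥κ.kerSubgroup) Φ.proj
            (fun g b ↦ Φ.proj_smul (g : absoluteGaloisGroup K) b))).addSubgroupOf
              (unramifiedOutside κ.kerSubgroup Φ.Quot p (↑Sf : Set (HeightOneSpectrum (𝓞 K))))) *
        Nat.card (ModN (unramifiedOutside κ.kerSubgroup ↥((W.baseChange K).geomPrimaryTorsion p) p
          (↑Sf : Set (HeightOneSpectrum (𝓞 K)))) p) =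
      Nat.card (ModN (unramifiedOutside κ.kerSubgroup (charModule (∅ : Set (PadicAlgCl p)) θsub) p
          (↑Sf : Set (HeightOneSpectrum (𝓞 K)))) p) *
        Nat.card (ModN (unramifiedOutside κ.kerSubgroup (charModule (∅ : Set (PadicAlgCl p)) θquot) p
          (↑Sf : Set (HeightOneSpectrum (𝓞 K)))) p) := by
  haveI hEK : (W.baseChange K).IsElliptic := inferInstanceAs (W.map (algebraMap ℚ K)).IsElliptic
  have hv : ((p : ℕ) : 𝓞 K) ∈ v.asIdeal := IwasawaTwoVariable.natCast_mem_asIdeal_of_norm_iff hvι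
  -- the places `Σ = {v, v̄} ∪ Sf ⊇ Sf ∪ {w ∣ p}`
  have hS : ∀ w : HeightOneSpectrum (𝓞 K), ((p : ℕ) : 𝓞 K) ∈ w.asIdeal →
      w ∈ (↑(insert v (insert vbar Sf)) : Set (HeightOneSpectrum (𝓞 K))) :=
    mem_insert_insert_of_natCast_mem hK hv hvbar hne Sf
  have hSfS : ∀ w ∈ Sf, w ∈ (↑(insert v (insert vbar Sf)) : Set (HeightOneSpectrum (𝓞 K))) := fun w hw ↦ by
    rw [Finset.coe_insert, Finset.coe_insert]
    exact Or.inr (Or.inr (Finset.mem_coe.mpr hw))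
  -- §1: the three descents
  obtain ⟨ρA₁, hρA₁⟩ := exists_descent_charModule W hpair Sf hSf _ hSfS hS θsub (Or.inl rfl)
  obtain ⟨ρA₃, hρA₃⟩ := exists_descent_charModule W hpair Sf hSf _ hSfS hS θquot (Or.inr rfl)
  obtain ⟨ρA₂, hρA₂⟩ := exists_descent_geomPrimaryTorsion (p := p) W Sf hSf _ hSfS hS
  -- weak Leopoldt above `K_∞` for the three descents (w2 gen 4)
  haveI : ContinuousSMul ℤ (charModule (∅ : Set (PadicAlgCl p)) θsub) := ⟨continuous_of_discreteTopology⟩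
  haveI : ContinuousSMul ℤ (charModule (∅ : Set (PadicAlgCl p)) θquot) := ⟨continuous_of_discreteTopology⟩
  haveI : ContinuousSMul ℤ ↥((W.baseChange K).geomPrimaryTorsion p) := ⟨continuous_of_discreteTopology⟩
  have hWL₁ : Subsingleton ((ρA₁.restrict
      (galoisGroupAboveSubtype (↑(insert v (insert vbar Sf)) : Set (HeightOneSpectrum (𝓞 K))) κ.kerSubgroup)).H 2) :=
    WeakLeopoldtAboveCharModuleAt.subsingleton_H_two_above_charModule_of_cotorsion_at hCD2 h41 h42 h5A h32 W hp hK hH hvι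
      hvbar hne κ hκ γ hpair Sf hSf θsub (Or.inl rfl) hSsub ρA₁ hρA₁
  have hWL₃ : Subsingleton ((ρA₃.restrict
      (galoisGroupAboveSubtype (↑(insert v (insert vbar Sf)) : Set (HeightOneSpectrum (𝓞 K))) κ.kerSubgroup)).H 2) :=
    WeakLeopoldtAboveCharModuleAt.subsingleton_H_two_above_charModule_of_cotorsion_at hCD2 h41 h42 h5A h32 W hp hK hH hvι
      hvbar hne κ hκ γ hpair Sf hSf θquot (Or.inr rfl) hSquot ρA₃ hρA₃
  have hWL₂ : Subsingleton ((ρA₂.restrict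
      (galoisGroupAboveSubtype (↑(insert v (insert vbar Sf)) : Set (HeightOneSpectrum (𝓞 K))) κ.kerSubgroup)).H 2) :=
    WeakLeopoldtAboveCurve.subsingleton_H_two_above_geomPrimaryTorsion hCD2 h41 h42 h5A h32 W hp hK hH hvι hvbar hne κ hκ γ
      hpair Sf hSf hSsub hSquot ρA₂ hρA₂
  -- the residual / Kummer data of (F)
  have hexact : ∀ b : ↥((W.baseChange K).geomTorsion (p : ℤ)), Φ.proj b = 0 → ∃ a : Φ.Sub, Φ.incl a = b :=
    fun b hb ↦ Φ.mem_range_incl_of_proj_eq_zero b hb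
  exact natCard_H2bookkeeping_unramifiedOutside_insert_insert hK hv hvbar hne Sf κ Φ.incl Φ.proj Φ.incl_smul Φ.proj_smul
    Φ.incl_injective Φ.proj_surjective hexact Φ.proj_incl
    j₁ (AddSubgroup.inclusion (geomTorsion_le_geomPrimaryTorsion (W.baseChange K) p)) j₃ hj₁ (fun _ _ ↦ rfl) hj₃
    hj₁inj (AddSubgroup.inclusion_injective _) hj₃inj
    hr₁ (IndexInputsH0.mem_range_inclusion_iff_nsmul_eq_zero W) hr₃
    (CharResidualSelmerCount.charModule_divisible θsub) (IndexInputsH0.exists_nsmul_eq_primaryTorsion W)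
    (CharResidualSelmerCount.charModule_divisible θquot)
    (Φ.continuous_smul_sub (continuous_smul_geomTorsion (W.baseChange K) (p : ℤ)))
    (continuous_smul_geomTorsion (W.baseChange K) (p : ℤ))
    (Φ.continuous_smul_quot (continuous_smul_geomTorsion (W.baseChange K) (p : ℤ)))
    ρA₁ ρA₂ ρA₃ hρA₁ hρA₂ hρA₃ hWL₁ hWL₂ hWL₃ hCD2

end Summit.BirchSwinnertonDyer.BirchSwinnertonDyer.Theorems.IndexInputsH2

end
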